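import Mathlib
import Literature.Analysis.FluidPDE.Tao2016AveragedNS.SelfSimilarCascadeBlowup
import HarnessLib

/-!
# Socket for «Barbato–Morandin–Romito at scale ratio 1+ε₀»: a global regular viscous CHAIN gives a global regular
# viscous solution of every scaled dyadic table, hence no Theorem-4.2 blow-up
# (helper file for the crux `SubOnsagerCeiling.ForwardTailCeilingKP`, stmt-NavierStokesRegularity-27057, `--supports`;
# hand leafhand-ns-subonsagerceiling-4 gen 23; route-independent module — no `Theses` import)

By gen 23's per-viscosity reduction (`Theorems/SubOnsagerCeilingPerViscositySuffices.lean`) the rung target consumes, on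
the KP class at small ratio, only PER-VISCOSITY GLOBAL REGULARITY: for every `ν > 0` a global regular solution of the
`ν`-viscous lattice (4.13), `ViscousGlobal ε₀ ν α X₀ X`.  For the one-mode chain class (`α = c·dyadicTable`, `c > 0`, the
skeleton's `IsScaledDyadic`) this file provides the adapter from the natural CHAIN currency — the shape in which a
Barbato–Morandin–Romito-type theorem at ratio `λ = 1 + ε₀` would be stated — to the lattice currency:

* `viscousGlobal_of_chainGlobal` — if `Z : ℤ → ℝ → ℝ` is a global regular solution of the scalar viscous chain
  `Ż_k = c((1+ε₀)^{5(k-1)/2} Z_{k-1}² − (1+ε₀)^{5k/2} Z_k Z_{k+1}) − ν(1+ε₀)^{2k} Z_k` on `[0, ∞)` (`C¹`, a-priori weight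
  `(1 + (1+ε₀)^{10k})|Z_k| ≤ M(T)` on `[0,T]`, datum `X₀ 0` at shell `0`, `Z_k ≡ 0` for `k < 0`), then the family
  `X_{0,n} = Z_n`, `X_{i,0} = X₀ i · e^{-νt}` (`i ≠ 0`), `X_{i,n} = 0` otherwise, is a global regular solution of the
  `ν`-viscous lattice of `α = c·dyadicTable` from the datum `X₀` (the off-chain components carry no nonlinearity,
  `quadTerm_dyadicTable_of_ne`, and decay freely);
* `not_noGlobalCascade_of_chainGlobal` — hence, if such a chain solution exists for EVERY `ν > 0` (datum `X₀ 0`), then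
  `¬NoGlobalCascade ε₀ α X₀` (κ-normal form `noGlobalCascade_iff_kappa` + `hasGlobal_of_viscousGlobal`; no uniformity in `ν`).

At `ε₀ = 1` the tree already holds the instance (`Literature…exists_viscousGlobal_one_dyadicTable`, BMR 2011 Thm. 1 at `λ = 2`,
non-negative datum on component `0`); removing the fixation `λ = 2` is posed as open in print (arXiv:1506.07480, p. 3).
HONEST FRAMING: an adapter between statements about Tao-type MODEL lattice ODEs (route SubOnsagerCeiling, rung TL-M2Break);
nothing is proved about the chain itself; no stub, crux, rung target or summit is proved and nothing bears on Navier–Stokes.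
[cite: Tao2016AveragedNS, §1.2, §4 (4.13), Thm. 4.2] [cite: BarbatoMorandinRomito2011, (1.1), Thm. 1]
-/

noncomputable section

-- the sub-problem namespace `NavierStokesRegularity.NavierStokesRegularity` is the tree's layout (D-0017)
set_option linter.dupNamespace false

namespace Summit.NavierStokesRegularity.NavierStokesRegularity.Theorems

open Set Filter
open scoped Topology
open Literature.Analysis.FluidPDE.TaoCascade

/-- **Chain ⇒ lattice (scaled dyadic tables).**  A global regular solution `Z` of the scalar `ν`-viscous Katz–Pavlović chain
at scale ratio `1 + ε₀` with coupling `c` and datum `X₀ 0` at shell `0` yields a global regular solution of the `ν`-viscous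
lattice (4.13) of the table `α = c·dyadicTable` from the full datum `X₀`: component `0` is the chain, the other components
keep their shell-`0` datum decaying as `e^{-νt}` and vanish elsewhere. MODEL lattice statement.
[cite: Tao2016AveragedNS, §1.2 (dyadic model system), §4 (4.13)] -/
theorem viscousGlobal_of_chainGlobal {ε₀ ν c : ℝ} (hν : 0 ≤ ν)
    {α : Fin 4 → Fin 4 → Fin 4 → ℤ × ℤ × ℤ → ℝ}
    (hα : ∀ (i₁ i₂ i₃ : Fin 4) (μ : ℤ × ℤ × ℤ), α i₁ i₂ i₃ μ = c * dyadicTable i₁ i₂ i₃ μ)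
    {X₀ : Fin 4 → ℝ} {Z : ℤ → ℝ → ℝ}
    (hZc : ∀ k : ℤ, ContDiffOn ℝ 1 (Z k) (Ici 0))
    (hZap : ∀ T : ℝ, 0 < T → ∃ M : ℝ, ∀ t ∈ Icc (0 : ℝ) T, ∀ k : ℤ,
      (1 + (1 + ε₀) ^ ((10 : ℝ) * k)) * |Z k t| ≤ M)
    (hZ0 : ∀ k : ℤ, Z k 0 = if k = 0 then X₀ 0 else 0)
    (hZode : ∀ (k : ℤ) (t : ℝ), 0 ≤ t → derivWithin (Z k) (Ici 0) t =
      c * ((1 + ε₀) ^ ((5 : ℝ) * (k - 1) / 2) * Z (k - 1) t ^ 2 -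
        (1 + ε₀) ^ ((5 : ℝ) * k / 2) * (Z k t * Z (k + 1) t)) - ν * (1 + ε₀) ^ ((2 : ℝ) * k) * Z k t)
    (hZlow : ∀ (k : ℤ) (t : ℝ), k < 0 → 0 ≤ t → Z k t = 0) :
    ∃ X : Fin 4 → ℤ → ℝ → ℝ, ViscousGlobal ε₀ ν α X₀ X := by
  classical
  -- the embedded family
  set X : Fin 4 → ℤ → ℝ → ℝ := fun i n t =>
    if i = 0 then Z n t else if n = 0 then X₀ i * Real.exp (-(ν * t)) else 0 with hXdef
  have hX0 : ∀ n t, X 0 n t = Z n t := fun n t => by simp [hXdef]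
  have hX0f : ∀ n, X 0 n = Z n := fun n => funext (hX0 n)
  have hXi0 : ∀ i, i ≠ 0 → ∀ t, X i 0 t = X₀ i * Real.exp (-(ν * t)) := fun i hi t => by simp [hXdef, hi]
  have hXi0f : ∀ i, i ≠ 0 → X i 0 = fun t => X₀ i * Real.exp (-(ν * t)) := fun i hi => funext (hXi0 i hi)
  have hXin : ∀ i, i ≠ 0 → ∀ n, n ≠ 0 → ∀ t, X i n t = 0 := fun i hi n hn t => by simp [hXdef, hi, hn]
  have hXinf : ∀ i, i ≠ 0 → ∀ n, n ≠ 0 → X i n = fun _ => 0 := fun i hi n hn => funext (hXin i hi n hn)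
  -- the nonlinearity of the embedded family
  have hQ0 : ∀ n t, quadTerm ε₀ α X 0 n t =
      c * ((1 + ε₀) ^ ((5 : ℝ) * (n - 1) / 2) * Z (n - 1) t ^ 2 -
        (1 + ε₀) ^ ((5 : ℝ) * n / 2) * (Z n t * Z (n + 1) t)) := by
    intro n t
    have hlin : quadTerm ε₀ α X 0 n t = c * quadTerm ε₀ dyadicTable X 0 n t := by
      simp only [quadTerm, hα, Finset.mul_sum]
      refine Finset.sum_congr rfl fun i₁ _ => Finset.sum_congr rfl fun i₂ _ =>
        Finset.sum_congr rfl fun μ _ => ?_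
      ring
    rw [hlin, quadTerm_dyadicTable_zero, hX0, hX0, hX0]
  have hQi : ∀ i, i ≠ 0 → ∀ n t, quadTerm ε₀ α X i n t = 0 := by
    intro i hi n t
    have hlin : quadTerm ε₀ α X i n t = c * quadTerm ε₀ dyadicTable X i n t := by
      simp only [quadTerm, hα, Finset.mul_sum]
      refine Finset.sum_congr rfl fun i₁ _ => Finset.sum_congr rfl fun i₂ _ =>
        Finset.sum_congr rfl fun μ _ => ?_
      ring
    rw [hlin, quadTerm_dyadicTable_of_ne ε₀ X hi, mul_zero]
  -- the free decay `X₀ i · e^{-νt}`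
  have hexp : ∀ (a t : ℝ), HasDerivAt (fun s => a * Real.exp (-(ν * s))) (-(ν * (a * Real.exp (-(ν * t))))) t := by
    intro a t
    have h1 : HasDerivAt (fun s => -(ν * s)) (-(ν * 1)) t := ((hasDerivAt_id t).const_mul ν).neg
    have h2 := (h1.exp).const_mul a
    exact h2.congr_deriv (by ring)
  refine ⟨X, ⟨?_, ?_, ?_, ?_, ?_⟩⟩
  · -- contDiffOn
    intro i n
    by_cases hi : i = 0
    · subst hi; rw [hX0f]; exact hZc n
    · by_cases hn : n = 0
      · subst hn; rw [hXi0f i hi]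
        exact (contDiff_const.mul (contDiff_const.mul contDiff_id).neg.exp).contDiffOn
      · rw [hXinf i hi n hn]; exact contDiffOn_const
  · -- a priori weight (4.5)
    intro T hT
    obtain ⟨M, hM⟩ := hZap T hT
    refine ⟨max M (2 * ∑ j : Fin 4, |X₀ j|), fun t ht i n => ?_⟩
    by_cases hi : i = 0
    · subst hi; rw [hX0]; exact (hM t ht n).trans (le_max_left _ _)
    · by_cases hn : n = 0
      · subst hn
        rw [hXi0 i hi]
        have hb : (1 + ε₀) ^ ((10 : ℝ) * ((0 : ℤ) : ℝ)) = 1 := by simp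
        rw [hb]
        have he : Real.exp (-(ν * t)) ≤ 1 := by
          rw [Real.exp_le_one_iff]; nlinarith [ht.1]
        have he0 : 0 < Real.exp (-(ν * t)) := Real.exp_pos _
        have hsum : |X₀ i| ≤ ∑ j : Fin 4, |X₀ j| :=
          Finset.single_le_sum (f := fun j => |X₀ j|) (fun j _ => abs_nonneg _) (Finset.mem_univ i)
        calc (1 + 1 : ℝ) * |X₀ i * Real.exp (-(ν * t))| = 2 * (|X₀ i| * Real.exp (-(ν * t))) := by
              rw [abs_mul, abs_of_pos he0]; ring
          _ ≤ 2 * (|X₀ i| * 1) := by gcongr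
          _ ≤ 2 * ∑ j : Fin 4, |X₀ j| := by simpa using hsum
          _ ≤ max M (2 * ∑ j : Fin 4, |X₀ j|) := le_max_right _ _
      · rw [hXin i hi n hn, abs_zero, mul_zero]
        exact le_trans (by positivity : (0 : ℝ) ≤ 2 * ∑ j : Fin 4, |X₀ j|) (le_max_right _ _)
  · -- initial datum
    intro i n
    by_cases hi : i = 0
    · subst hi; rw [hX0, hZ0]
    · by_cases hn : n = 0
      · subst hn; rw [hXi0 i hi]; simp
      · rw [hXin i hi n hn, if_neg hn]
  · -- equation of motion (4.13)
    intro i n t ht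
    by_cases hi : i = 0
    · subst hi
      rw [hX0f, hQ0, hZode n t ht]
    · rw [hQi i hi]
      by_cases hn : n = 0
      · subst hn
        rw [hXi0f i hi, ((hexp (X₀ i) t).hasDerivWithinAt).derivWithin (uniqueDiffOn_Ici 0 t ht)]
        have hb : (1 + ε₀) ^ ((2 : ℝ) * ((0 : ℤ) : ℝ)) = 1 := by simp
        rw [hb]; ring
      · rw [hXinf i hi n hn]
        simp
  · -- no very low frequencies
    intro i n t hn ht
    by_cases hi : i = 0
    · subst hi; rw [hX0]; exact hZlow n t hn ht
    · exact hXin i hi n (by omega) t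

/-- **Per-viscosity global regularity of the chain forbids Theorem-4.2 blow-up for scaled dyadic tables.**  If for every
`ν > 0` the scalar `ν`-viscous chain at ratio `1 + ε₀` (coupling `c`) has a global regular solution from the datum `X₀ 0` at
shell `0`, then `¬NoGlobalCascade ε₀ (c·dyadicTable) X₀`: by `viscousGlobal_of_chainGlobal`, `hasGlobal_of_viscousGlobal`
(a regular `ν`-viscous solution is a global `(ν√2, 0)`-pseudo-solution) and the κ-normal form `noGlobalCascade_iff_kappa`.
No uniformity in `ν` is used. MODEL lattice statement. [cite: Tao2016AveragedNS, §4 Thm. 4.2, (4.13)] -/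
theorem not_noGlobalCascade_of_chainGlobal {ε₀ c : ℝ} (hε : 0 < ε₀)
    {α : Fin 4 → Fin 4 → Fin 4 → ℤ × ℤ × ℤ → ℝ}
    (hα : ∀ (i₁ i₂ i₃ : Fin 4) (μ : ℤ × ℤ × ℤ), α i₁ i₂ i₃ μ = c * dyadicTable i₁ i₂ i₃ μ)
    {X₀ : Fin 4 → ℝ}
    (hchain : ∀ ν : ℝ, 0 < ν → ∃ Z : ℤ → ℝ → ℝ,
      (∀ k : ℤ, ContDiffOn ℝ 1 (Z k) (Ici 0)) ∧
      (∀ T : ℝ, 0 < T → ∃ M : ℝ, ∀ t ∈ Icc (0 : ℝ) T, ∀ k : ℤ, (1 + (1 + ε₀) ^ ((10 : ℝ) * k)) * |Z k t| ≤ M) ∧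
      (∀ k : ℤ, Z k 0 = if k = 0 then X₀ 0 else 0) ∧
      (∀ (k : ℤ) (t : ℝ), 0 ≤ t → derivWithin (Z k) (Ici 0) t =
        c * ((1 + ε₀) ^ ((5 : ℝ) * (k - 1) / 2) * Z (k - 1) t ^ 2 -
          (1 + ε₀) ^ ((5 : ℝ) * k / 2) * (Z k t * Z (k + 1) t)) - ν * (1 + ε₀) ^ ((2 : ℝ) * k) * Z k t) ∧
      (∀ (k : ℤ) (t : ℝ), k < 0 → 0 ≤ t → Z k t = 0)) :
    ¬ NoGlobalCascade ε₀ α X₀ := by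
  rw [noGlobalCascade_iff_kappa hε]
  rintro ⟨κ, hκ, hno⟩
  have h2 : 0 < Real.sqrt 2 := Real.sqrt_pos.2 two_pos
  have hν : 0 < κ / Real.sqrt 2 := div_pos hκ h2
  obtain ⟨Z, hZc, hZap, hZ0, hZode, hZlow⟩ := hchain (κ / Real.sqrt 2) hν
  obtain ⟨X, hX⟩ := viscousGlobal_of_chainGlobal hν.le hα hZc hZap hZ0 hZode hZlow
  have hG := hasGlobal_of_viscousGlobal hε hν.le hX
  rw [div_mul_cancel₀ κ h2.ne'] at hG
  exact hno (hasGlobal_mono hε.le hG le_rfl hκ.le)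

end Summit.NavierStokesRegularity.NavierStokesRegularity.Theorems

end
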